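import Summits.CriticalPhenomena.CardyFormulaZ2.Theses.DyadicBetaRigidity

/-!
# The normalised incomplete beta law `I_a(η) = ∫₀^η (s(1-s))^{-a} ds / ∫₀¹ (s(1-s))^{-a} ds`,
# and the dyadic mesh arithmetic

Support file for `DyadicBetaSuffices` (route DyadicBetaRigidity of `CardyFormulaZ2`, item
stmt-CriticalPhenomena-18184), elementary real analysis: for an exponent `a < 1` the kernel
`(s(1-s))^{-a}` is integrable on `[0, 1]`, the complete integral is positive, the law `I_a` is
continuous on `[0, 1]` and symmetric, `I_a(1 - η) = 1 - I_a(η)` (substitution `s ↦ 1 - s`). Cardy's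
function is `I_{2/3}`; the proofs are those of
`Literature.Probability.RandomPlanarGeometry.incBeta13_*` with `2/3` replaced by `a`. Finally
`exists_mesh_decomposition`: every mesh `δ ≤ d / 2^(m₀+K+1)` is `δ = c · d/(N·2ⁿ)` with `N` in the
dyadic window `[2^m₀, 2^(m₀+1))`, `n ≥ K` and a factor `c ∈ (N/(N+1), 1]` (geometric cover of one
factor-`2` window by the meshes `d/N`).

References: G. E. Andrews, R. Askey, R. Roy, *Special Functions* (1999), Def. 1.1.3;
B. Bollobás, O. Riordan, *Percolation* (2006), Ch. 7 eq. (4).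
-/

noncomputable section

namespace Summit.CriticalPhenomena.CardyFormulaZ2.Theorems

namespace DyadicLattice

open Set MeasureTheory Filter Topology

variable {a : ℝ}

/-- The beta kernel `(s(1-s))^{-a}` is positive on `(0, 1)`. [folklore] -/
theorem symmBetaKernel_pos (a : ℝ) {s : ℝ} (hs : s ∈ Ioo (0 : ℝ) 1) : 0 < (s * (1 - s)) ^ (-a) :=
  Real.rpow_pos_of_pos (mul_pos hs.1 (by linarith [hs.2])) _

/-- The beta kernel is symmetric under `s ↦ 1 - s`. [folklore] -/
theorem symmBetaKernel_one_sub (a s : ℝ) : ((1 - s) * (1 - (1 - s))) ^ (-a) = (s * (1 - s)) ^ (-a) := by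
  rw [sub_sub_cancel, mul_comm]

/-- Integrability of `(s(1-s))^{-a}`, `a < 1`, on `[0, 1/2]`: there the kernel is `s^{-a}` times a
continuous function (Andrews–Askey–Roy 1999, Def. 1.1.3). [cite: AndrewsAskeyRoy1999, Def. 1.1.3] -/
theorem intervalIntegrable_symmBetaKernel_half (ha : a < 1) :
    IntervalIntegrable (fun s : ℝ ↦ (s * (1 - s)) ^ (-a)) volume 0 (1 / 2) := by
  have h1 : IntervalIntegrable (fun s : ℝ ↦ s ^ (-a)) volume 0 (1 / 2) :=
    intervalIntegral.intervalIntegrable_rpow' (by linarith)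
  have h2 : ContinuousOn (fun s : ℝ ↦ (1 - s) ^ (-a)) (uIcc 0 (1 / 2)) := by
    refine ContinuousOn.rpow_const (continuousOn_const.sub continuousOn_id) fun s hs ↦ Or.inl ?_
    rw [uIcc_of_le (by norm_num : (0 : ℝ) ≤ 1 / 2)] at hs
    have := hs.2
    intro h
    linarith
  refine (h1.mul_continuousOn h2).congr_uIoo fun s hs ↦ ?_
  rw [uIoo_of_le (by norm_num : (0 : ℝ) ≤ 1 / 2)] at hs
  simp only
  rw [Real.mul_rpow hs.1.le (by linarith [hs.2])]

/-- The kernel `(s(1-s))^{-a}`, `a < 1`, is integrable on `[0, 1]` (the beta integral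
`B(1-a, 1-a)` converges; Andrews–Askey–Roy 1999, Def. 1.1.3). [cite: AndrewsAskeyRoy1999, Def. 1.1.3] -/
theorem intervalIntegrable_symmBetaKernel (ha : a < 1) :
    IntervalIntegrable (fun s : ℝ ↦ (s * (1 - s)) ^ (-a)) volume 0 1 := by
  refine (intervalIntegrable_symmBetaKernel_half ha).trans ?_
  -- on `[1/2, 1]` use the symmetry `s ↦ 1 - s`
  have h := (intervalIntegrable_symmBetaKernel_half ha).comp_sub_left 1
  simp only [symmBetaKernel_one_sub] at h
  norm_num at h
  exact h.symm

/-- The kernel is integrable on every subinterval of `[0, 1]`. [folklore] -/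
theorem intervalIntegrable_symmBetaKernel_of_mem (ha : a < 1) {u v : ℝ} (hu : u ∈ Icc (0 : ℝ) 1)
    (hv : v ∈ Icc (0 : ℝ) 1) : IntervalIntegrable (fun s : ℝ ↦ (s * (1 - s)) ^ (-a)) volume u v :=
  (intervalIntegrable_symmBetaKernel ha).mono_set (by
    rw [uIcc_of_le zero_le_one]
    exact uIcc_subset_Icc hu hv)

/-- The incomplete beta integral `∫₀^u (s(1-s))^{-a} ds` is positive for `u ∈ (0, 1]`. [folklore] -/
theorem incBeta_pos (ha : a < 1) {u : ℝ} (hu : u ∈ Ioc (0 : ℝ) 1) :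
    0 < ∫ s in (0 : ℝ)..u, (s * (1 - s)) ^ (-a) :=
  intervalIntegral.intervalIntegral_pos_of_pos_on
    (intervalIntegrable_symmBetaKernel_of_mem ha ⟨le_rfl, zero_le_one⟩ ⟨hu.1.le, hu.2⟩)
    (fun _ hs ↦ symmBetaKernel_pos a ⟨hs.1, hs.2.trans_le hu.2⟩) hu.1

/-- The complete beta integral `∫₀¹ (s(1-s))^{-a} ds` is positive. [folklore] -/
theorem beta_pos (ha : a < 1) : 0 < ∫ s in (0 : ℝ)..1, (s * (1 - s)) ^ (-a) :=
  incBeta_pos ha ⟨one_pos, le_rfl⟩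

/-- `u ↦ ∫₀^u (s(1-s))^{-a} ds` is continuous on `[0, 1]` (a primitive of an integrable function).
[folklore] -/
theorem continuousOn_incBeta (ha : a < 1) :
    ContinuousOn (fun u : ℝ ↦ ∫ s in (0 : ℝ)..u, (s * (1 - s)) ^ (-a)) (Icc 0 1) := by
  have := intervalIntegral.continuousOn_primitive_interval' (intervalIntegrable_symmBetaKernel ha)
    (a := 0) (by simp)
  rwa [uIcc_of_le zero_le_one] at this

/-- **Continuity of the beta law**: `I_a` is continuous on `[0, 1]`, hence on `(0, 1)`. [folklore] -/
theorem continuousOn_betaLaw (ha : a < 1) :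
    ContinuousOn (fun η : ℝ ↦ (∫ s in (0 : ℝ)..η, (s * (1 - s)) ^ (-a)) /
      ∫ s in (0 : ℝ)..1, (s * (1 - s)) ^ (-a)) (Ioo 0 1) :=
  ((continuousOn_incBeta ha).div_const _).mono Ioo_subset_Icc_self

/-- The symmetry `∫₀^{1-u} = ∫₀¹ - ∫₀^u` of the incomplete beta integral with equal parameters
(substitution `s ↦ 1 - s`; Bollobás–Riordan 2006, Ch. 7, eq. (4)). [cite: BollobasRiordan2006, Ch. 7 eq. (4)] -/
theorem incBeta_one_sub (ha : a < 1) {u : ℝ} (hu : u ∈ Icc (0 : ℝ) 1) :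
    (∫ s in (0 : ℝ)..(1 - u), (s * (1 - s)) ^ (-a)) =
      (∫ s in (0 : ℝ)..1, (s * (1 - s)) ^ (-a)) - ∫ s in (0 : ℝ)..u, (s * (1 - s)) ^ (-a) := by
  have h1 : (∫ s in (0 : ℝ)..(1 - u), (s * (1 - s)) ^ (-a)) =
      ∫ s in u..1, (s * (1 - s)) ^ (-a) := by
    have := intervalIntegral.integral_comp_sub_left (a := u) (b := 1)
      (fun s : ℝ ↦ (s * (1 - s)) ^ (-a)) 1
    simp only [symmBetaKernel_one_sub, sub_self] at this
    rw [← this]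
  rw [h1, ← intervalIntegral.integral_add_adjacent_intervals
      (intervalIntegrable_symmBetaKernel_of_mem ha ⟨le_rfl, zero_le_one⟩ hu)
      (intervalIntegrable_symmBetaKernel_of_mem ha hu ⟨zero_le_one, le_rfl⟩)]
  ring

/-- **Symmetry of the beta law**: `I_a(1 - η) = 1 - I_a(η)` for `η ∈ [0, 1]`
(Bollobás–Riordan 2006, Ch. 7, eq. (4), for `a = 2/3`). [cite: BollobasRiordan2006, Ch. 7 eq. (4)] -/
theorem betaLaw_one_sub' (ha : a < 1) {η : ℝ} (hη : η ∈ Icc (0 : ℝ) 1) :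
    (∫ s in (0 : ℝ)..(1 - η), (s * (1 - s)) ^ (-a)) / (∫ s in (0 : ℝ)..1, (s * (1 - s)) ^ (-a)) =
      1 - (∫ s in (0 : ℝ)..η, (s * (1 - s)) ^ (-a)) / ∫ s in (0 : ℝ)..1, (s * (1 - s)) ^ (-a) := by
  rw [incBeta_one_sub ha hη, sub_div, div_self (beta_pos ha).ne']

/-- **Symmetry of the beta law** (registered form of `betaLaw_one_sub'`, stub of item
stmt-CriticalPhenomena-18184): `I_a(1 - η) = 1 - I_a(η)` for `η ∈ [0, 1]`, `a < 1`.
[cite: BollobasRiordan2006, Ch. 7 eq. (4)] -/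
theorem betaLaw_one_sub : ∀ {a : ℝ}, a < 1 → ∀ {η : ℝ}, η ∈ Set.Icc (0 : ℝ) 1 → (∫ s in (0 : ℝ)..(1 - η), (s * (1 - s)) ^ (-a)) / (∫ s in (0 : ℝ)..1, (s * (1 - s)) ^ (-a)) = 1 - (∫ s in (0 : ℝ)..η, (s * (1 - s)) ^ (-a)) / ∫ s in (0 : ℝ)..1, (s * (1 - s)) ^ (-a) := by
  intro a ha η hη
  exact betaLaw_one_sub' ha hη

/-! ### Dyadic mesh arithmetic -/

/-- **Every small mesh is a near-trivial dilate of a dyadic refinement of one of finitely many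
meshes `d/N`.** For `0 < δ ≤ d / 2^(m₀+K+1)` there are `N ∈ [2^m₀, 2^(m₀+1))`, `n ≥ K` and
`c ∈ (N/(N+1), 1]` with `δ = c · (d/N)/2ⁿ`. [folklore] -/
theorem exists_mesh_decomposition {d : ℝ} (hd : 0 < d) (m₀ K : ℕ) {δ : ℝ} (hδ : 0 < δ)
    (hδ' : δ ≤ d / 2 ^ (m₀ + K + 1)) :
    ∃ N : ℕ, 2 ^ m₀ ≤ N ∧ N < 2 ^ (m₀ + 1) ∧ ∃ n : ℕ, K ≤ n ∧ ∃ c : ℝ,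
      (N : ℝ) / (N + 1) < c ∧ c ≤ 1 ∧ δ = c * (d / N / 2 ^ n) := by
  have h2 : (1 : ℝ) < 2 := one_lt_two
  -- `x := d / δ / 2^m₀ ≥ 2^(K+1) ≥ 1`
  have hx : (2 : ℝ) ^ (K + 1) ≤ d / δ / 2 ^ m₀ := by
    rw [le_div_iff₀ (by positivity), le_div_iff₀ hδ]
    calc (2 : ℝ) ^ (K + 1) * 2 ^ m₀ * δ = 2 ^ (m₀ + K + 1) * δ := by ring
      _ ≤ 2 ^ (m₀ + K + 1) * (d / 2 ^ (m₀ + K + 1)) := by gcongr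
      _ = d := by field_simp
  have hx1 : (1 : ℝ) ≤ d / δ / 2 ^ m₀ := (one_le_pow₀ one_le_two).trans hx
  obtain ⟨n, hn1, hn2⟩ := exists_nat_pow_near hx1 h2
  -- `K ≤ n`
  have hKn : K ≤ n := by
    have h' : (2 : ℝ) ^ (K + 1) < 2 ^ (n + 1) := hx.trans_lt hn2
    have := (pow_lt_pow_iff_right₀ h2).1 h'
    omega
  -- `y := d / δ / 2^n ∈ [2^m₀, 2^(m₀+1))`
  set y : ℝ := d / δ / 2 ^ n with hy
  have hy1 : (2 : ℝ) ^ m₀ ≤ y := by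
    rw [hy, le_div_iff₀ (by positivity)]
    rw [le_div_iff₀ (by positivity)] at hn1
    linarith
  have hy2 : y < (2 : ℝ) ^ (m₀ + 1) := by
    rw [hy, div_lt_iff₀ (by positivity)]
    rw [div_lt_iff₀ (by positivity)] at hn2
    calc d / δ < 2 ^ (n + 1) * 2 ^ m₀ := hn2
      _ = 2 ^ (m₀ + 1) * 2 ^ n := by ring
  have hy0 : 0 < y := lt_of_lt_of_le (by positivity) hy1
  set N : ℕ := ⌊y⌋₊ with hN
  have hN1 : 2 ^ m₀ ≤ N := by
    rw [hN, Nat.le_floor_iff hy0.le]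
    exact_mod_cast hy1
  have hN2 : N < 2 ^ (m₀ + 1) := by
    rw [hN, Nat.floor_lt hy0.le]
    exact_mod_cast hy2
  have hNy : (N : ℝ) ≤ y := Nat.floor_le hy0.le
  have hyN : y < (N : ℝ) + 1 := Nat.lt_floor_add_one y
  have hN0 : (0 : ℝ) < N := by
    have h1 : (1 : ℝ) ≤ 2 ^ m₀ := one_le_pow₀ one_le_two
    have h3 : ((2 ^ m₀ : ℕ) : ℝ) ≤ N := by exact_mod_cast hN1
    push_cast at h3
    linarith
  refine ⟨N, hN1, hN2, n, hKn, N / y, ?_, ?_, ?_⟩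
  · rw [div_lt_div_iff_of_pos_left hN0 (by positivity) hy0]
    exact hyN
  · rw [div_le_one hy0]
    exact hNy
  · have hδ0 := hδ.ne'
    have hd0 := hd.ne'
    have hN0' := hN0.ne'
    rw [hy]
    field_simp

end DyadicLattice

end Summit.CriticalPhenomena.CardyFormulaZ2.Theorems
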